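import Summits.ABC.IUTFork.Joshi.DictionaryUntiltsVolume
import Summits.ABC.IUTFork.Joshi.UntiltRescaled
import Summits.ABC.IUTFork.Cor312PinnedCountermodel
import Summits.ABC.IUTFork.Cor312CheckBGluedScaledNonVacuity
import HarnessLib

/-!
# JOINT NON-VACUITY of the E1-side location theorem: all premises of
# `UntiltPoints.not_movesAreInd_and_datumEquivariant` (p431910) hold together in ONE model

Test/model file of the abc-iut cell, branch E (seat abc-iut-E-t1, [J-I] carrier owner; E-cx-3 lane (1) double-read; rung
LADDER-ABC:A2.E; E-PLAN R14: Test* file, may import `Cor312*`). TAKES NO SIDE on [IUTchIII] Cor. 3.12 or on any author; typed ≠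
proved ≠ endorsed. Everything below is PROVED over landed models: the points side is `threePoint p 4` of `UntiltRescaled` (p432361:
residue fields `ℂ_p` at `e₁` and `ℂ_p^{(4)}` elsewhere, the swap ∈ Aut(𝔽₂²) moving `e₁` to `e₂` — exponent ratio `1 : 4`, i.e. the
`j = 2` instance of Joshi's `|−|_{K_j} = |−|^{j²}_{K_1}`, [J-IIp] Thm 6.9.1 / [J-III] (4.2.2.2)); the packet side is abc-iut-w5-d247's
naive model `naiveFull q` with abc-iut-w4-d101's HONEST region operator `PinnedWitness.orbitRegion` (p418585/p419720): (hρ) =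
`orbitRegion_equivariant`, (Ind1)/(Ind2) preserve admissibility and log-volume (`NaiveWitness.naiveData_adm_iff_image`,
`naiveData_logvolInvariant`, p4196xx), and the reading `locDatum`: the holomorphic structure `e₁` reads as the q-pilot datum
`{(±q)_j}` (`PinnedWitness.qDatum`, region `B_1` at every nonzero label), the others as the Θ-datum `{(±q^{j²})_j}` (`NaiveWitness.Psi`,
region `B_{j²}`): at label `2` the log-volumes are `−log q` and `−4·log q = κ · exponent` with `κ = −log q ≠ 0` — `ExponentFaithful`.
RESULT: `locationPremises_satisfiable` — (hρ) ∧ (hAdm) ∧ `LogvolInvariant` ∧ admissibility of all data regions ∧ `ExponentFaithful` ∧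
`ActionDilates` hold SIMULTANEOUSLY; hence (`location_fires`) in this model NO realisation `real : Aut(𝔽₂²) → PacketAut` and no choice of
`base`, `std` makes `MovesAreInd ∧ DatumEquivariant` true — the location theorem is not vacuous, and its conclusion is witnessed on a
model where Joshi's reading «q-pilot = Θ-datum in a rescaled holomorphic structure» is LITERALLY the datum assignment. Toy level
(one place, `l⋇ = 2`, formal ball volumes); no side taken. [folklore]
-/

noncomputable section

open Set

namespace Summit.ABC.IUTFork.Joshi

open Summit.ABC.IUTFork.Thm311 Summit.ABC.IUTFork.Cor312 Summit.ABC.IUTFork.Cor312Vol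
open Summit.ABC.IUTFork.Cor312.Checks Summit.ABC.IUTFork.Cor312.IdentifiedNonVacuity
open Cor312Vol.NaiveWitness Cor312Vol.PinnedWitness

variable (p : ℕ) [Fact p.Prime] (q : ℕ) [hq : Fact q.Prime]

/-- `0 < 4` in `ℝ` (the exponent ratio of the model). [folklore] -/
theorem fourPos : (0 : ℝ) < 4 := by norm_num

open Classical in
/-- THE READING of the three-point signature's holomorphic structures as bad-place Kummer data of the naive model: `e₁ ↦ {(±q)_j}`
(the q-pilot datum), the two rescaled structures `↦ {(±q^{j²})_j}` (the Θ-datum). [folklore] -/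
def locDatum (y : ProjPoints (ZMod 2) (ZMod 2 × ZMod 2)) : ∀ v : toyIndex.V, v ∈ toyIndex.Vbad → Set (signShells.StarPacket v) :=
  if y = e1 then PinnedWitness.qDatum q else fun v _ => NaiveWitness.Psi q v

open Classical in
/-- The region of the reading at a nonzero label is a ball: `B_1` at `e₁`, `B_{j²}` elsewhere. [folklore] -/
theorem orbitRegion_locDatum {j : toyIndex.Label} (hj : j ≠ 0) (vQ : toyIndex.VQ) (y : ProjPoints (ZMod 2) (ZMod 2 × ZMod 2)) :
    orbitRegion q (locDatum q y) j vQ = pBall q j vQ (if y = e1 then 1 else jsq j) := by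
  unfold locDatum
  split_ifs
  · exact orbitRegion_qDatum q hj vQ
  · exact orbitRegion_Psi q j vQ

/-- Every region of the reading is admissible (a ball; at label `0` the unit ball). [folklore] -/
theorem adm_orbitRegion_locDatum (n : ℤ) (y : ProjPoints (ZMod 2) (ZMod 2 × ZMod 2)) (j : toyIndex.Label) (vQ : toyIndex.VQ) :
    ((naiveFull q).toLatticeSituation.D n).Adm j vQ (orbitRegion q (locDatum q y) j vQ) := by
  show ∃ k, orbitRegion q (locDatum q y) j vQ = pBall q j vQ k
  by_cases hj : j = 0
  · subst hj; exact ⟨0, orbitRegion_zero q _ vQ⟩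
  · exact ⟨_, orbitRegion_locDatum q hj vQ y⟩

open Classical in
/-- At label `2` the log-volume of the reading's region is `(−log q) · expo`: `−log q` at `e₁` (ball `B_1`), `−4·log q` elsewhere
(ball `B_4`). [folklore] -/
theorem logvol_locDatum_two (n : ℤ) (y : ProjPoints (ZMod 2) (ZMod 2 × ZMod 2)) :
    ((naiveFull q).toLatticeSituation.D n).logvol 2 () (orbitRegion q (locDatum q y) 2 ()) = -Real.log q * expo 4 y := by
  rw [orbitRegion_locDatum q (by decide) () y]
  show pVol q 2 () (pBall q 2 () (if y = e1 then 1 else jsq 2)) = _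
  rw [pVol_pBall]
  unfold expo
  have h4 : jsq (2 : toyIndex.Label) = 4 := by decide
  by_cases hy : y = e1
  · rw [if_pos hy, if_pos hy]; push_cast; ring
  · rw [if_neg hy, if_neg hy, h4]; push_cast; ring

/-- **`ExponentFaithful` HOLDS** for the reading over `threePoint p 4`: at label `2` (place `()`) the log-volume of the region is
`(−log q) · exponent` (`−log q · 1` at `e₁`, `−log q · 4` elsewhere). [folklore] -/
theorem exponentFaithful_locDatum (n : ℤ) :
    UntiltPoints.ExponentFaithful (threePoint p 4 fourPos) (naiveFull q).toLatticeSituation n (orbitRegion q)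
      (locDatum q) := by
  refine ⟨(2 : toyIndex.Label), (), -Real.log q, neg_ne_zero.2 (log_p_pos q).ne', fun y => ?_⟩
  rw [exponent_threePoint]
  exact logvol_locDatum_two q n y

/-- **JOINT SATISFIABILITY of the premises of the E1 location theorem** (`DictionaryUntiltsVolume.not_movesAreInd_and_datumEquivariant`):
one points-signature (`threePoint p 4`), one typed-Thm-3.11 situation (`naiveFull q`), one region operator (`orbitRegion`), one reading
(`locDatum`) for which (hρ), (hAdm), `LogvolInvariant`, admissibility of all data regions, `ExponentFaithful` AND Joshi's `ActionDilates`
hold together. [folklore] -/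
theorem locationPremises_satisfiable (n : ℤ) :
    (∀ Φ ∈ Subgroup.closure (signShells.Ind1Family ∪ signShells.Ind2Family),
        ∀ (Ψ : ∀ v : toyIndex.V, v ∈ toyIndex.Vbad → Set (signShells.StarPacket v)) (j : toyIndex.Label) (vQ : toyIndex.VQ),
          orbitRegion q (fun v hv => signShells.starAut Φ v '' Ψ v hv) j vQ = Φ j vQ '' orbitRegion q Ψ j vQ) ∧
      (∀ Φ ∈ signShells.Ind1Family ∪ signShells.Ind2Family, ∀ (j : toyIndex.Label) (vQ : toyIndex.VQ)
        (A : Set (signShells.Packet j vQ)),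
          ((naiveFull q).toLatticeSituation.D n).Adm j vQ A ↔ ((naiveFull q).toLatticeSituation.D n).Adm j vQ (Φ j vQ '' A)) ∧
      ((naiveFull q).toLatticeSituation.D n).LogvolInvariant ∧
      (∀ (y : (threePoint p 4 fourPos).Pt) (j : toyIndex.Label) (vQ : toyIndex.VQ),
        ((naiveFull q).toLatticeSituation.D n).Adm j vQ (orbitRegion q (locDatum q y) j vQ)) ∧
      UntiltPoints.ExponentFaithful (threePoint p 4 fourPos) (naiveFull q).toLatticeSituation n (orbitRegion q)
        (locDatum q) ∧
      (threePoint p 4 fourPos).ActionDilates :=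
  ⟨fun Φ hΦ Ψ j vQ => orbitRegion_equivariant q hΦ Ψ j vQ, naiveData_adm_iff_image q, naiveData_logvolInvariant q,
    adm_orbitRegion_locDatum q n, exponentFaithful_locDatum p q n, threePoint_actionDilates p 4 fourPos (by norm_num)⟩

/-- **THE LOCATION FIRES in the model**: for EVERY realisation `real : Aut(𝔽₂²) → PacketAut` of Joshi's moves as packet automorphisms
and every choice of `base`, `std`, the dictionary `toDictionary` over (`threePoint p 4`, `locDatum`) does NOT satisfy
`MovesAreInd ∧ DatumEquivariant` — by the location theorem applied to the jointly satisfied premises. In words (no side taken): in a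
setting whose (Ind1)/(Ind2) preserve log-volume, Joshi's dilating change of holomorphic structure (here `e₁ ↦ e₂`, exponent `1 ↦ 4`,
reading `{(±q)_j} ↦ {(±q^{j²})_j}`) is NOT an indeterminacy acting equivariantly. [folklore] -/
theorem location_fires (n : ℤ) (base std : (threePoint p 4 fourPos).Pt)
    (real : (threePoint p 4 fourPos).Aut → signShells.PacketAut) :
    ¬ (MovesAreInd ((threePoint p 4 fourPos).toDictionary (naiveFull q).toLatticeSituation base std (locDatum q) real) ∧
        DatumEquivariant ((threePoint p 4 fourPos).toDictionary (naiveFull q).toLatticeSituation base std (locDatum q) real)) := by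
  have h := locationPremises_satisfiable p q n
  exact UntiltPoints.not_movesAreInd_and_datumEquivariant (D := threePoint p 4 fourPos) n (orbitRegion q) h.1 h.2.1 h.2.2.1
    h.2.2.2.1 h.2.2.2.2.1 h.2.2.2.2.2

end Summit.ABC.IUTFork.Joshi

end
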